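import Summits.QuantumFields.BalabanUV.T4Continuum.Spine.NE3.PairLandauB8Avg
import Literature.MathematicalPhysics.QuantumFieldTheory.Balaban1983to89.B7Prop3GeneralTild
import HarnessLib

/-!
# T⁴ programme, node NE3 — REPAIR R24 (α): THE TREE's LINEARISED DOUBLE-BAR AVERAGE `Qbar` IS THE b07 LINEAGE's «L(Q(V₀)A)_c» (`linQcov`,
# [Balaban1985Averaging] (122)) READ IN THE END-FRAMED CHART — the dictionary `A = Ad_W Y` between the two typed linearisations of the
# double-bar average (89)∕(120), so that [B7] Prop. 3's analytic half ((123), `ShellMeasureAverageProp3Remainder`) and the exact right inverse of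
# the main term ((125), `B7Eq125RightInverse`) become available to the chart supplier on B8's slice `slicB8`

Cell `pub-balaban-gaps` (YM blitz, track G2, seat `ne3`, unit `pub-balaban-gaps-ne3`; writer prover-pub-balaban-gaps-ne3-g2-0, 2026-08-22), census
`run/shared/lean/pub/pub-balaban-gaps/ne/NE3.md` §4 R24 (ii)(α).  Inputs BY NAME: T4's one-level linearised objects `AveragingDeficitTransport.dhol`
(left-trivialised derivative of parallel transport along `V·e^{sψ}`), `AveragingDeficitSideDeriv.sideDeriv` ∕ `hasDerivAt_val_bavg_vary` («d/ds|₀ V̄_s(c) =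
δV̄(c)·V̄(c)»), `AveragingDeficitResidualPairing.pushDir = Ad_{V̄(c)}⁻¹ sideDeriv`, `BlockAveragePushDirSplit.frameLin` ∕ `dbarLin`,
`NE3TangentCovariantStructure.Qbar`; the b07 lineage's `B7Prop3GeneralRotated.tsum` ((115) «(R_{0,y}A)(Γ)»), `B7Prop3GeneralLinear.FhatCov` ∕ `Qcov` ∕
`linQcov` ((112)∕(121)∕(122)), `B7Prop3GeneralTild.QprimeCov` ∕ `hasDerivAt_tild_expCfg` ∕ `linQcov_eq` ((113)–(120)), `B7Prop3Flat.expCfg` ((109)),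
`B7Eq78Linearization.conjR`; and `Spine/NE3/PairLandauB8Avg.relPert` (p341788).

THE DICTIONARY (reading (R-g) of `PairLandauB8Avg`, now at the Lie-algebra level).  b07 perturbs on the LEFT in the START frame, `V₁V₀ = e^{tA}·V₀`
(`expCfg (t•A) * V₀`); T4 perturbs on the RIGHT in the END frame, `V₀·e^{tY}` (`vary V₀ Y t`).  These are THE SAME configuration for all `t` iff
`A = Ad_{V₀} Y` bondwise (`adField`); then every derived linear object agrees up to the obvious conjugations:
* `tsum V₀ (adField V₀ Y) = dhol V₀ Y` (word by word; `tstep` vs `dstep`, `conjR` IS `Ad`);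
* `FhatCov L V₀ (adField V₀ Y) = frameLin L V₀ Y` (the linearised block frames (112));
* `QprimeCov L V₀ (adField V₀ Y) c = sideDeriv L V₀ Y c` (the two closed forms of `d/dt|₀ Ṽ(c)`, by UNIQUENESS of the derivative of
  `t ↦ \overline{V₀e^{tY}}(c)·V̄₀(c)⁻¹` over `ℝ` — b07's complex derivative restricted to the real line vs T4's `hasDerivAt_val_bavg_vary`);
* hence **`dbarLin L V₀ Y c = Ad_{V̄₀(c)}⁻¹ (linQcov L V₀ (adField V₀ Y) c)`** and **`Qbar L V₀ Y (z, κ) = Ad_{V̄₀(L•z, κ)}⁻¹ (linQcov L V₀ (adField V₀ Y) (L•z, κ))`**: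
  the tree's linearised double-bar average IS print's «L(Q(V₀)A)_c» in the end frame of the coarse bond — under the one-block loop smallness
  `‖Wcx L V₀ c r − 1‖ < 1` that both lineages use for their derivative formulas.
Also `relPert W Z = expCfg (adField W Z)` (`rfl`): the (1.37) clause of `LandauRepB8Avg` is `dbavgCovIter L W (expCfg (adField W Z)) k = 1`, whose one-level
logarithm is b07's `Qcov`.

CONTENT (0 sorry; one DATA def `adField`): §1 `adField`, `relPert_eq_expCfg_adField`, `expCfg_smul_adField_mul` (`e^{t·Ad_W Y}·W = W·e^{tY}`, complex `t`);
§2 `tstep_adField`, `tsum_adField`, `FhatCov_adField`; §3 `hasDerivAt_tild_adField_real` (T4 side, over `ℝ`), `QprimeCov_adField`; §4 `dbarLin_eq_Ad_linQcov`,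
**`Qbar_eq_Ad_linQcov`**.

HONEST FRAMING.  Exact kinematic identities between two typings of [Balaban1985Averaging] Sect. D at a fixed background; nothing about Bałaban's minimisers;
the chart supplier (R24 (β)(γ)), (P♮), (RES♯), the covariant root and **NE3 are NOT proved**; spine PROVED 0∕9; finite T⁴ rung (B)+1 — NOT infinite volume,
NOT mass gap, NOT `BetaPertH`, NOT Clay.  ABSOLUTE RULE kept (context only: [Balaban1985Averaging] (109)–(125) pp. 34–36).  PLACEMENT:
`Summits/QuantumFields/BalabanUV/T4Continuum/Spine/NE3/` (consumer side of R24; imports the Spine shape file it serves and the Literature b07 module);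
moves nothing.  HONEST DEPENDENCY: continuum YM on T⁴ ⇐ BetaPertH ∧ nine spine estimates (0/9 proved); BetaPertH ⇐ (D1) ∧ (D4) ∧ CAP+tail; G-an2-4
gates asym, D1 and NE2/3/4.
-/

set_option autoImplicit false

open scoped BigOperators Matrix Matrix.Norms.L2Operator
open NormedSpace Finset

namespace Summit.QuantumFields.BalabanUV.T4Continuum.NE3.QbarDictionary

open Literature.MathematicalPhysics.QuantumFieldTheory.Balaban1983to89
open B7Prop1Explicit B7Prop2Explicit B7Prop3Flat
open T4AveragingDeficitWall (Ad vary)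
open AveragingDeficitNearIdentity (Ad_add Ad_neg Ad_smul)
open AveragingDeficitTransport (dstep dhol dhol_cons)
open AveragingDeficitSideDeriv (sideDeriv hasDerivAt_val_bavg_vary)
open AveragingDeficitResidualPairing (pushDir)
open BlockAveragePushDirSplit (frameLin dbarLin)
open NE3TangentCovariantStructure (Qbar)
open NE3GaugeDirFrames (Ad_Ad_inv)
open B7Eq78Linearization (conjR)
open B7Prop3GeneralRotated (tstep tsum tsum_cons)
open B7Prop3GeneralLinear (FhatCov linQcov)
open B7Prop3GeneralTild (QprimeCov hasDerivAt_tild_expCfg linQcov_eq)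
open B7Eq92Concrete (tild Rc Rc_apply expUnit_conj)
open NE3.PairLandauB8Avg (relPert)

noncomputable section

variable {d : ℕ} {n : Type*} [Fintype n] [DecidableEq n]

/-! ## §1 The Lie-algebra dictionary `A = Ad_W Y` -/

/-- **THE START-FRAMED FIELD OF AN END-FRAMED DIRECTION**: `adField W Y (b) = Ad_{W(b)} Y(b) = W(b)Y(b)W(b)⁻¹` — b07's perturbation variable `A` of
(109) `V₁ = e^{A}` for the tree's right chart `W·e^{Y}`.  A DATA definition. [folklore] -/
def adField (W : Site d → Fin d → (Matrix n n ℂ)ˣ) (Y : Site d → Fin d → Matrix n n ℂ) : Site d → Fin d → Matrix n n ℂ :=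
  fun x μ => Ad (W x μ) (Y x μ)

/-- The left-chart perturbation of `PairLandauB8Avg` IS `expCfg` of the start-framed field (definitionally). [folklore] -/
theorem relPert_eq_expCfg_adField (W : Site d → Fin d → (Matrix n n ℂ)ˣ) (Z : Site d → Fin d → Matrix n n ℂ) :
    relPert W Z = expCfg (adField W Z) := rfl

/-- **`e^{t·Ad_W Y}·W = W·e^{tY}` BONDWISE, complex `t`**: b07's perturbed configuration `expCfg (t•A) * V₀` with `A = adField V₀ Y` is T4's complex
perturbation of `V₀` along `Y` ([Balaban1985Averaging] (57) `exp(XAX⁻¹) = R(X)exp A`). [folklore] -/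
theorem expCfg_smul_adField_mul (W : Site d → Fin d → (Matrix n n ℂ)ˣ) (Y : Site d → Fin d → Matrix n n ℂ) (t : ℂ) :
    expCfg (t • adField W Y) * W = fun x μ => W x μ * expUnit (t • Y x μ) := by
  funext x μ
  show expCfg (t • adField W Y) x μ * W x μ = W x μ * expUnit (t • Y x μ)
  have h : expCfg (t • adField W Y) x μ = Rc (W x μ) (expUnit (t • Y x μ)) := by
    unfold expCfg adField
    rw [Pi.smul_apply, Pi.smul_apply, ← Ad_smul]
    unfold Ad
    exact expUnit_conj (W x μ) (t • Y x μ)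
  rw [h, Rc_apply, inv_mul_cancel_right]

/-! ## §2 Transported sums and linearised frames agree -/

/-- One letter: b07's `tstep V₀ (adField V₀ Y)` is T4's `dstep V₀ Y` (positive letter: `A(b) = Ad_{V₀(b)}Y(b)`; negative letter:
`−R(V₀(b))⁻¹A(b) = −Y(b)`). [folklore] -/
theorem tstep_adField (W : Site d → Fin d → (Matrix n n ℂ)ˣ) (Y : Site d → Fin d → Matrix n n ℂ) (x : Site d) (l : Letter d) :
    tstep W (adField W Y) x l = dstep W Y x l := by
  obtain ⟨μ, b⟩ := l
  cases b
  · -- negative letter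
    simp only [tstep, dstep, adField, stepHol, conjR, Ad, Bool.false_eq_true, ↓reduceIte, inv_inv, neg_inj]
    rw [← mul_assoc, ← mul_assoc, Units.inv_mul, one_mul, mul_assoc, Units.inv_mul, mul_one]
  · -- positive letter
    simp [tstep, dstep, adField]

/-- **Every word: `tsum V₀ (adField V₀ Y) x Γ = dhol V₀ Y x Γ`** — «(R_{0,x}A)(Γ)» of [Balaban1985Averaging] p. 28∕(115) IS the tree's left-trivialised
derivative of parallel transport, for `A = Ad_{V₀} Y` (`conjR` is `Ad`). [folklore] -/
theorem tsum_adField (W : Site d → Fin d → (Matrix n n ℂ)ˣ) (Y : Site d → Fin d → Matrix n n ℂ) :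
    ∀ (x : Site d) (w : List (Letter d)), tsum W (adField W Y) x w = dhol W Y x w
  | x, [] => rfl
  | x, l :: w => by
    rw [tsum_cons, dhol_cons, tstep_adField, tsum_adField W Y (x + l.vec) w]
    rfl

/-- **The linearised block frames agree: `FhatCov L V₀ (adField V₀ Y) y = frameLin L V₀ Y y`** ((112)). [folklore] -/
theorem FhatCov_adField (L : ℕ) (W : Site d → Fin d → (Matrix n n ℂ)ˣ) (Y : Site d → Fin d → Matrix n n ℂ) (y : Site d) :
    FhatCov L W (adField W Y) y = frameLin L W Y y := by
  unfold FhatCov frameLin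
  exact Finset.sum_congr rfl fun r _ => by rw [tsum_adField]

/-! ## §3 The two closed forms of `d/dt|₀ Ṽ(c)` agree -/

/-- T4's side of the derivative of the relative average, over `ℝ`: `s ↦ \overline{V₀·e^{sY}}(c)·V̄₀(c)⁻¹` has derivative `sideDeriv L V₀ Y c` at `0`
(`hasDerivAt_val_bavg_vary` times the constant `V̄₀(c)⁻¹`). [folklore] -/
theorem hasDerivAt_bavg_vary_mul_inv (L : ℕ) (W : Site d → Fin d → (Matrix n n ℂ)ˣ) (Y : Site d → Fin d → Matrix n n ℂ) (q : Site d)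
    (κ : Fin d) (hW : ∀ r : Fin d → Fin L, ‖((Wcx L W q κ (boxVec L r) : (Matrix n n ℂ)ˣ) : Matrix n n ℂ) - 1‖ < 1) :
    HasDerivAt (fun s : ℝ => ((bavg L (vary W Y s) q κ : (Matrix n n ℂ)ˣ) : Matrix n n ℂ) * (((bavg L W q κ)⁻¹ : (Matrix n n ℂ)ˣ) : Matrix n n ℂ))
      (sideDeriv L W Y q κ) 0 := by
  have h := (hasDerivAt_val_bavg_vary L W Y q κ hW).mul_const (((bavg L W q κ)⁻¹ : (Matrix n n ℂ)ˣ) : Matrix n n ℂ)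
  rwa [mul_assoc, Units.mul_inv, mul_one] at h

/-- b07's side restricted to the real line: `s ↦ Ṽ(c)` along `expCfg ((s:ℂ)•adField V₀ Y)` IS the function of the previous lemma, with derivative
`QprimeCov L V₀ (adField V₀ Y) c` at `0`. [folklore] -/
theorem hasDerivAt_tild_adField_real [Nonempty n] (L : ℕ) (W : Site d → Fin d → (Matrix n n ℂ)ˣ) (Y : Site d → Fin d → Matrix n n ℂ) (q : Site d)
    (κ : Fin d) (hW : ∀ r : Fin d → Fin L, ‖((Wcx L W q κ (boxVec L r) : (Matrix n n ℂ)ˣ) : Matrix n n ℂ) - 1‖ < 1) :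
    HasDerivAt (fun s : ℝ => ((bavg L (vary W Y s) q κ : (Matrix n n ℂ)ˣ) : Matrix n n ℂ) * (((bavg L W q κ)⁻¹ : (Matrix n n ℂ)ˣ) : Matrix n n ℂ))
      (QprimeCov L W (adField W Y) q κ) 0 := by
  have hC := hasDerivAt_tild_expCfg L W (adField W Y) q κ hW
  have hg := (hasDerivAt_id (0 : ℝ)).ofReal_comp
  have h := hC.scomp_of_eq (0 : ℝ) hg (by simp)
  have hR : HasDerivAt (fun s : ℝ => ((tild L W (expCfg (((s : ℂ)) • adField W Y)) q κ : (Matrix n n ℂ)ˣ) : Matrix n n ℂ))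
      (QprimeCov L W (adField W Y) q κ) 0 := by
    convert h using 1 <;> first | rfl | rw [Complex.ofReal_one, one_smul]
  refine hR.congr_of_eventuallyEq (Filter.Eventually.of_forall fun s => ?_)
  show ((bavg L (vary W Y s) q κ : (Matrix n n ℂ)ˣ) : Matrix n n ℂ) * (((bavg L W q κ)⁻¹ : (Matrix n n ℂ)ˣ) : Matrix n n ℂ)
    = ((tild L W (expCfg (((s : ℂ)) • adField W Y)) q κ : (Matrix n n ℂ)ˣ) : Matrix n n ℂ)
  unfold tild
  rw [expCfg_smul_adField_mul]
  rfl

/-- **`QprimeCov L V₀ (adField V₀ Y) c = sideDeriv L V₀ Y c`** — [Balaban1985Averaging] (113)–(119)'s «(Q′(V₀)A)_c» (b07's closed form of `d/dt|₀ Ṽ(c)`)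
IS T4's `sideDeriv` for `A = Ad_{V₀} Y`, by uniqueness of the real derivative (one-block loop smallness `‖Wcx − 1‖ < 1`). [folklore] -/
theorem QprimeCov_adField [Nonempty n] (L : ℕ) (W : Site d → Fin d → (Matrix n n ℂ)ˣ) (Y : Site d → Fin d → Matrix n n ℂ) (q : Site d) (κ : Fin d)
    (hW : ∀ r : Fin d → Fin L, ‖((Wcx L W q κ (boxVec L r) : (Matrix n n ℂ)ˣ) : Matrix n n ℂ) - 1‖ < 1) :
    QprimeCov L W (adField W Y) q κ = sideDeriv L W Y q κ :=
  (hasDerivAt_tild_adField_real L W Y q κ hW).unique (hasDerivAt_bavg_vary_mul_inv L W Y q κ hW)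

/-! ## §4 The linearised double-bar averages agree up to the end-frame conjugation of the coarse bond -/

/-- **`dbarLin L V₀ Y c = Ad_{V̄₀(c)}⁻¹ (linQcov L V₀ (adField V₀ Y) c)`** — the tree's linearised double-bar average (end frame of the coarse bond `c`) is
b07's «L(Q(V₀)A)_c» ([Balaban1985Averaging] (122), start frame) conjugated back, for `A = Ad_{V₀}Y`; one-block loop smallness `‖Wcx − 1‖ < 1`. [folklore] -/
theorem dbarLin_eq_Ad_linQcov [Nonempty n] (L : ℕ) (W : Site d → Fin d → (Matrix n n ℂ)ˣ) (Y : Site d → Fin d → Matrix n n ℂ) (q : Site d) (κ : Fin d)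
    (hW : ∀ r : Fin d → Fin L, ‖((Wcx L W q κ (boxVec L r) : (Matrix n n ℂ)ˣ) : Matrix n n ℂ) - 1‖ < 1) :
    dbarLin L W Y q κ = Ad (bavg L W q κ)⁻¹ (linQcov L W (adField W Y) q κ) := by
  rw [linQcov_eq L W (adField W Y) q κ hW, QprimeCov_adField L W Y q κ hW, FhatCov_adField, FhatCov_adField]
  unfold dbarLin pushDir
  have hc : conjR (bavg L W q κ) (frameLin L W Y (q + (L : ℤ) • e κ)) = Ad (bavg L W q κ) (frameLin L W Y (q + (L : ℤ) • e κ)) := rfl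
  have hAA : Ad (bavg L W q κ)⁻¹ (Ad (bavg L W q κ) (frameLin L W Y (q + (L : ℤ) • e κ))) = frameLin L W Y (q + (L : ℤ) • e κ) := by
    have h := Ad_Ad_inv (bavg L W q κ)⁻¹ (frameLin L W Y (q + (L : ℤ) • e κ))
    rwa [inv_inv] at h
  rw [hc, Ad_add, Ad_add, Ad_neg, hAA]
  abel

/-- **`Qbar L V₀ Y (z, κ) = Ad_{V̄₀(L•z, κ)}⁻¹ (linQcov L V₀ (adField V₀ Y) (L•z, κ))`** — the coarse reading: the tree's `Qbar` IS print's linear part of the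
double-bar average, read in the end frame.  Consequence for R24: [B7] Prop. 3's remainder bound (123) (`ShellMeasureAverageProp3Remainder.prop3_general_remainder`,
on `Qcov = linQcov + Ccov`) and the exact right inverse of the main term (125) (`B7Eq125RightInverse`) apply to the constraint `QbarIter = 0` of `slicB8`. [folklore] -/
theorem Qbar_eq_Ad_linQcov [Nonempty n] (L : ℕ) (W : Site d → Fin d → (Matrix n n ℂ)ˣ) (Y : Site d → Fin d → Matrix n n ℂ) (z : Site d) (κ : Fin d)
    (hW : ∀ r : Fin d → Fin L, ‖((Wcx L W ((L : ℤ) • z) κ (boxVec L r) : (Matrix n n ℂ)ˣ) : Matrix n n ℂ) - 1‖ < 1) :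
    Qbar L W Y z κ = Ad (bavg L W ((L : ℤ) • z) κ)⁻¹ (linQcov L W (adField W Y) ((L : ℤ) • z) κ) :=
  dbarLin_eq_Ad_linQcov L W Y ((L : ℤ) • z) κ hW

end

end Summit.QuantumFields.BalabanUV.T4Continuum.NE3.QbarDictionary
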